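import Literature.Analysis.OperatorTheory.PositiveKernelSpectralTrace
import Literature.Analysis.OperatorTheory.HeterogeneousCyclicPeeling
import HarnessLib

/-!
# Crux `IR` (stmt-QuantumFields-19354), line `vacuum_escape`, seam `stub_cheeger` — part 1: cyclic slice-chain integrals with
# one-site and adjacent two-site insertions as spectral sums

Helper module for item `stmt-QuantumFields-19354` (`--supports … --as helper`; closes nothing by itself).  Abstract setting (the
tree's `Literature/Analysis/OperatorTheory` toolkit): a probability space `(X, μ)`, a bounded symmetric strongly measurable kernel `K`,
its `L²` operator `A` (`A φ =ᵐ ∫ K(·,y) φ(y)`), a countable Hilbert basis of eigenvectors `A bᵢ = λᵢ bᵢ`.  For bounded measurable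
one-site weights `f, g : X → ℝ` the cyclic integral of the periodic chain of `m + 2` sites with `f` inserted at site `0` and `g` at
site `1`,

  `∫ (∏_{t : Fin (m+2)} K(W t, W (t+1))) · f(W 0) g(W 1) dμ^{⊗(m+2)}(W) = Σᵢ λᵢ^{m+1} ⟪bᵢ, 𝒳_{f,g} bᵢ⟫`   (`m ≥ 1`),

where `𝒳_{f,g}` is the `L²` operator of the bounded kernel `f(x) K(x,y) g(y)` (`hasSum_cyclic_insert_fg`, from the tree's
`HeterogeneousCyclicPeeling.integral_cyclic_insert_one` and `PositiveKernelSpectralTrace.hasSum_integral_iterate_insert_one`, after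
re-indexing the cycle `Fin (1 + m' + 1) ≃ Fin (m + 2)`), and the matrix elements `⟪bᵢ, 𝒳_{f,g} bᵢ⟫ = ∫ f bᵢ · κ(g bᵢ)`
(`inner_fgOp_eq`), `= λᵢ ∫ f bᵢ²` for `g = 1` (`inner_fgOp_one_eq`).  With `f = g = 1_A` these are the numerators of the slice-chain
probabilities `sliceMass`, `sliceStay` of the line `vacuum_escape` (part 2 takes the `m → ∞` limits and runs Lawler–Sokal).

HONEST FRAMING: transfer-operator bookkeeping; nothing here bears on weak coupling or the YM mass gap.
Refs: M. Reed, B. Simon, *Methods of Modern Mathematical Physics I*, Thm. VI.22–23; B. Simon, *Trace Ideals*, Ch. 3; tree files named above.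
-/

set_option autoImplicit false

noncomputable section

open MeasureTheory Filter Set Function
open scoped RealInnerProductSpace ENNReal Topology
open Literature.Analysis.OperatorTheory

namespace Summit.QuantumFields.YangMills.Cruxes.IR.VacuumEscape.Spectral

variable {X : Type*} [MeasurableSpace X] {μ : Measure X} [IsProbabilityMeasure μ]

/-! ## Re-indexing a cyclic integral along `Fin n ≃ Fin n'` -/

omit [IsProbabilityMeasure μ] in
/-- Transport of a cyclic integral with a two-site insertion along an equality of cycle lengths (the integrand only sees the
cyclic structure `t ↦ t + 1` and the sites `0, 1`, which `Fin.cast` preserves). -/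
theorem integral_cyclic_cast {n n' : ℕ} [NeZero n] [NeZero n'] (h : n = n') (Ψ : X → X → ℝ) (w : X → X → ℝ) :
    ∫ W : Fin n' → X, (∏ s, Ψ (W s) (W (s + 1))) * w (W 0) (W 1) ∂(Measure.pi fun _ => μ) =
      ∫ V : Fin n → X, (∏ s, Ψ (V s) (V (s + 1))) * w (V 0) (V 1) ∂(Measure.pi fun _ => μ) := by
  subst h
  rfl

omit [MeasurableSpace X] [IsProbabilityMeasure μ] in
/-- Cutting the cycle `Fin (n + 1)` at the bond `(0, 1)`: the periodic weight times a two-site insertion at `0, 1` is the inserted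
bond kernel `w(V 0, V 1) Ψ(V 0, V 1)` times the open product over the remaining bonds `(t+1, t+2)`. -/
theorem prod_cyclic_mul_two_site {n : ℕ} [NeZero n] (Ψ : X → X → ℝ) (w : X → X → ℝ) (V : Fin (n + 1) → X) :
    (∏ s : Fin (n + 1), Ψ (V s) (V (s + 1))) * w (V 0) (V 1) =
      (w (V 0) (V 1) * Ψ (V 0) (V 1)) * ∏ t : Fin n, Ψ (V t.succ) (V (t.succ + 1)) := by
  rw [Fin.prod_univ_succ]
  simp only [zero_add]
  ring

/-! ## The cyclic integral with insertions at sites `0` and `1` as a spectral sum -/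

section Spectral

variable {K : X → X → ℝ} {C : ℝ} {A : Lp ℝ 2 μ →L[ℝ] Lp ℝ 2 μ} {ι : Type*} [Countable ι]
  {b : HilbertBasis ι ℝ (Lp ℝ 2 μ)} {lam : ι → ℝ}

/-- The bond kernel `f(x) K(x,y) g(y)` of a two-site insertion is strongly measurable. -/
theorem stronglyMeasurable_fgKernel (hK : StronglyMeasurable (uncurry K)) {f g : X → ℝ} (hf : Measurable f)
    (hg : Measurable g) : StronglyMeasurable (uncurry fun x y => f x * K x y * g y) :=
  ((hf.comp measurable_fst).stronglyMeasurable.mul hK).mul (hg.comp measurable_snd).stronglyMeasurable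

omit [MeasurableSpace X] in
/-- The bond kernel `f(x) K(x,y) g(y)` is bounded by `B_f C B_g`. -/
theorem norm_fgKernel_le (hC : ∀ x y, ‖K x y‖ ≤ C) {f g : X → ℝ} {Bf Bg : ℝ} (hfb : ∀ x, ‖f x‖ ≤ Bf)
    (hgb : ∀ x, ‖g x‖ ≤ Bg) (x y : X) : ‖f x * K x y * g y‖ ≤ Bf * C * Bg := by
  have hBf : 0 ≤ Bf := (norm_nonneg _).trans (hfb x)
  have hC0 : 0 ≤ C := (norm_nonneg _).trans (hC x y)
  rw [norm_mul, norm_mul]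
  exact mul_le_mul (mul_le_mul (hfb x) (hC x y) (norm_nonneg _) hBf) (hgb y) (norm_nonneg _) (mul_nonneg hBf hC0)

/-- **Cyclic integral with insertions at `0` and `1` = spectral sum** (`m ≥ 1` written `m = M + 1`): for bounded measurable `f, g` and an
`L²` operator `𝒳` of the bond kernel `f(x)K(x,y)g(y)`,
`Σᵢ λᵢ^{M+2} ⟪bᵢ, 𝒳 bᵢ⟫ = ∫ (∏_{t : Fin (M+3)} K(W t, W (t+1))) f(W 0) g(W 1) dμ^{⊗(M+3)}`. -/
theorem hasSum_cyclic_insert_fg (hK : StronglyMeasurable (uncurry K)) (hC : ∀ x y, ‖K x y‖ ≤ C)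
    (hsymm : ∀ x y, K x y = K y x) (hA : ∀ φ : Lp ℝ 2 μ, (A φ : X → ℝ) =ᵐ[μ] fun x => ∫ y, K x y * φ y ∂μ)
    (hb : ∀ i, A (b i) = lam i • b i) {f g : X → ℝ} (hf : Measurable f) (hg : Measurable g) {Bf Bg : ℝ}
    (hfb : ∀ x, ‖f x‖ ≤ Bf) (hgb : ∀ x, ‖g x‖ ≤ Bg) {Xop : Lp ℝ 2 μ →L[ℝ] Lp ℝ 2 μ}
    (hXop : ∀ φ : Lp ℝ 2 μ, (Xop φ : X → ℝ) =ᵐ[μ] fun x => ∫ y, (f x * K x y * g y) * φ y ∂μ) (M : ℕ) :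
    HasSum (fun i => lam i ^ (M + 2) * ⟪b i, Xop (b i)⟫)
      (∫ W : Fin (M + 1 + 2) → X, (∏ t, K (W t) (W (t + 1))) * (f (W 0) * g (W 1)) ∂(Measure.pi fun _ => μ)) := by
  set Xk : X → X → ℝ := fun x y => f x * K x y * g y with hXk
  have hXm : StronglyMeasurable (uncurry Xk) := stronglyMeasurable_fgKernel hK hf hg
  have hXb : ∀ x y, ‖Xk x y‖ ≤ Bf * C * Bg := norm_fgKernel_le hC hfb hgb
  -- the spectral sum for the nested integral
  have hsum := hasSum_integral_iterate_insert_one (μ := μ) hK hC hsymm hA hb hXm hXb hXop M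
  -- common bound for the peeling lemma
  set C' : ℝ := max C (Bf * C * Bg) with hC'
  have hKb' : ∀ x y, ‖K x y‖ ≤ C' := fun x y => (hC x y).trans (le_max_left _ _)
  have hXb' : ∀ x y, ‖Xk x y‖ ≤ C' := fun x y => (hXb x y).trans (le_max_right _ _)
  have hpeel := integral_cyclic_insert_one (ρ := μ) (X := Xk) (K := K) hXm.measurable hK.measurable hXb' hKb' (M + 1)
  -- re-index the cycle `Fin (M + 1 + 2) ≃ Fin (1 + (M + 1) + 1)` and cut it at the bond `(0, 1)`
  have hcast := integral_cyclic_cast (μ := μ) (show 1 + (M + 1) + 1 = M + 1 + 2 by ring) K (fun x y => f x * g y)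
  have hcut : ∀ V : Fin (1 + (M + 1) + 1) → X, (∏ s, K (V s) (V (s + 1))) * (f (V 0) * g (V 1)) =
      Xk (V 0) (V 1) * ∏ t : Fin (1 + (M + 1)), K (V t.succ) (V (t.succ + 1)) := by
    intro V
    rw [prod_cyclic_mul_two_site K (fun x y => f x * g y) V, hXk]
    ring
  rw [hcast]
  simp_rw [hcut]
  rw [hpeel]
  exact hsum

omit [IsProbabilityMeasure μ] [Countable ι] in
/-- **Matrix elements of the insertion operator**: `⟪bᵢ, 𝒳_{f,g} bᵢ⟫ = ∫ f(x) bᵢ(x) (∫ K(x,y) g(y) bᵢ(y) dμ(y)) dμ(x)`. -/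
theorem inner_fgOp_eq {f g : X → ℝ} {Xop : Lp ℝ 2 μ →L[ℝ] Lp ℝ 2 μ}
    (hXop : ∀ φ : Lp ℝ 2 μ, (Xop φ : X → ℝ) =ᵐ[μ] fun x => ∫ y, (f x * K x y * g y) * φ y ∂μ) (i : ι) :
    ⟪b i, Xop (b i)⟫ = ∫ x, f x * b i x * ∫ y, K x y * (g y * b i y) ∂μ ∂μ := by
  rw [inner_kernelOp_eq_integral hXop]
  refine integral_congr_ae (Eventually.of_forall fun x => ?_)
  simp only
  rw [← integral_const_mul, ← integral_const_mul]
  refine integral_congr_ae (Eventually.of_forall fun y => ?_)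
  ring

omit [IsProbabilityMeasure μ] [Countable ι] in
/-- **One-site insertion**: for `g = 1`, `⟪bᵢ, 𝒳_{f,1} bᵢ⟫ = λᵢ ∫ f bᵢ² dμ` (the eigen-equation `κ bᵢ = λᵢ bᵢ` a.e.). -/
theorem inner_fgOp_one_eq
    (hA : ∀ φ : Lp ℝ 2 μ, (A φ : X → ℝ) =ᵐ[μ] fun x => ∫ y, K x y * φ y ∂μ)
    (hb : ∀ i, A (b i) = lam i • b i) {f : X → ℝ} {Xop : Lp ℝ 2 μ →L[ℝ] Lp ℝ 2 μ}
    (hXop : ∀ φ : Lp ℝ 2 μ, (Xop φ : X → ℝ) =ᵐ[μ] fun x => ∫ y, (f x * K x y * 1) * φ y ∂μ) (i : ι) :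
    ⟪b i, Xop (b i)⟫ = lam i * ∫ x, f x * (b i x) ^ 2 ∂μ := by
  have h1 := inner_fgOp_eq (μ := μ) (K := K) (b := b) (f := f) (g := fun _ => (1 : ℝ)) hXop i
  rw [h1, ← integral_const_mul]
  -- `∫ K(x,y) bᵢ(y) = λᵢ bᵢ(x)` for a.e. `x`
  have hev : ∀ᵐ x ∂μ, ∫ y, K x y * b i y ∂μ = lam i * b i x := by
    have h2 : (A (b i) : X → ℝ) =ᵐ[μ] fun x => lam i * b i x := by
      rw [hb i]
      filter_upwards [Lp.coeFn_smul (lam i) (b i)] with x hx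
      rw [hx, Pi.smul_apply, smul_eq_mul]
    filter_upwards [hA (b i), h2] with x hx h2x
    rw [← hx, h2x]
  refine integral_congr_ae ?_
  filter_upwards [hev] with x hx
  simp only [one_mul]
  rw [hx]
  ring

end Spectral

/-! ## The `m → ∞` limit of normalised spectral sums with a simple dominant term -/

section Limits

variable {ι : Type*} [DecidableEq ι] {r c : ι → ℝ} {i₀ : ι} {ϑ B : ℝ}

omit [DecidableEq ι] in
/-- Termwise domination off the top index: `|rᵢ^{n+2} cᵢ| ≤ B ϑ₊ⁿ rᵢ²` for `i ≠ i₀` (`0 ≤ rᵢ ≤ ϑ ≤ ϑ₊ = max ϑ 0`, `|cᵢ| ≤ B`). -/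
theorem abs_pow_mul_le_of_ne (hr0 : ∀ i, 0 ≤ r i) (hrϑ : ∀ i, i ≠ i₀ → r i ≤ ϑ) (hc : ∀ i, |c i| ≤ B)
    {i : ι} (hi : i ≠ i₀) (n : ℕ) : |r i ^ (n + 2) * c i| ≤ B * (max ϑ 0) ^ n * r i ^ 2 := by
  have hB : 0 ≤ B := (abs_nonneg _).trans (hc i)
  have hri : r i ≤ max ϑ 0 := (hrϑ i hi).trans (le_max_left _ _)
  rw [abs_mul, abs_of_nonneg (pow_nonneg (hr0 i) _), pow_add, mul_comm (r i ^ n), mul_assoc]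
  calc r i ^ 2 * (r i ^ n * |c i|) ≤ r i ^ 2 * ((max ϑ 0) ^ n * B) := by
        refine mul_le_mul_of_nonneg_left ?_ (sq_nonneg _)
        exact mul_le_mul (pow_le_pow_left₀ (hr0 i) hri n) (hc i) (abs_nonneg _) (pow_nonneg (le_max_right _ _) _)
    _ = B * (max ϑ 0) ^ n * r i ^ 2 := by ring

/-- **Dominated limit of a spectral sum.**  If `0 ≤ rᵢ`, `r_{i₀} = 1`, `rᵢ ≤ ϑ < 1` for `i ≠ i₀`, `Σ rᵢ² < ∞` and `|cᵢ| ≤ B`, then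
`|Σᵢ rᵢ^{n+2} cᵢ − c_{i₀}| ≤ B ϑ₊ⁿ Σᵢ rᵢ²`, hence `Σᵢ rᵢ^{n+2} cᵢ → c_{i₀}` (`n → ∞`): the top term dominates, the rest decays
geometrically (Perron–Frobenius–Jentzsch asymptotics of `Tr(Θ 𝕋ⁿ)/λ₀ⁿ`). -/
theorem abs_tsum_pow_mul_sub_le (hr0 : ∀ i, 0 ≤ r i) (hri₀ : r i₀ = 1) (hϑ : ϑ < 1) (hrϑ : ∀ i, i ≠ i₀ → r i ≤ ϑ)
    (hsum : Summable fun i => r i ^ 2) (hc : ∀ i, |c i| ≤ B) (n : ℕ) :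
    Summable (fun i => r i ^ (n + 2) * c i) ∧
      |∑' i, r i ^ (n + 2) * c i - c i₀| ≤ B * (max ϑ 0) ^ n * ∑' i, r i ^ 2 := by
  have hB : 0 ≤ B := (abs_nonneg _).trans (hc i₀)
  have hϑ0 : 0 ≤ max ϑ 0 := le_max_right _ _
  have hϑ1 : max ϑ 0 ≤ 1 := max_le hϑ.le zero_le_one
  have hr1 : ∀ i, r i ≤ 1 := fun i => by
    by_cases hi : i = i₀
    · rw [hi, hri₀]
    · exact (hrϑ i hi).trans ((le_max_left _ _).trans hϑ1)
  -- summability by comparison with `B rᵢ²`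
  have hdom : ∀ i, ‖r i ^ (n + 2) * c i‖ ≤ B * r i ^ 2 := by
    intro i
    have e : |r i ^ (n + 2) * c i| = r i ^ 2 * (r i ^ n * |c i|) := by
      rw [abs_mul, abs_of_nonneg (pow_nonneg (hr0 i) _), pow_add]; ring
    rw [Real.norm_eq_abs, e]
    calc r i ^ 2 * (r i ^ n * |c i|) ≤ r i ^ 2 * (1 * B) :=
          mul_le_mul_of_nonneg_left (mul_le_mul (pow_le_one₀ (hr0 i) (hr1 i)) (hc i) (abs_nonneg _) zero_le_one)
            (sq_nonneg _)
      _ = B * r i ^ 2 := by ring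
  have hS : Summable (fun i => r i ^ (n + 2) * c i) := Summable.of_norm_bounded (hsum.mul_left B) hdom
  refine ⟨hS, ?_⟩
  rw [hS.tsum_eq_add_tsum_ite i₀, hri₀, one_pow, one_mul, add_sub_cancel_left]
  -- the remainder
  have hdom' : ∀ i, ‖(if i = i₀ then 0 else r i ^ (n + 2) * c i)‖ ≤ B * (max ϑ 0) ^ n * r i ^ 2 := by
    intro i
    split_ifs with hi
    · rw [norm_zero]; exact mul_nonneg (mul_nonneg hB (pow_nonneg hϑ0 _)) (sq_nonneg _)
    · rw [Real.norm_eq_abs]; exact abs_pow_mul_le_of_ne hr0 hrϑ hc hi n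
  have hS' : Summable fun i => B * (max ϑ 0) ^ n * r i ^ 2 := hsum.mul_left _
  calc |∑' i, (if i = i₀ then 0 else r i ^ (n + 2) * c i)|
      = ‖∑' i, (if i = i₀ then 0 else r i ^ (n + 2) * c i)‖ := (Real.norm_eq_abs _).symm
    _ ≤ ∑' i, B * (max ϑ 0) ^ n * r i ^ 2 := tsum_of_norm_bounded hS'.hasSum hdom'
    _ = B * (max ϑ 0) ^ n * ∑' i, r i ^ 2 := tsum_mul_left

/-- The limit form: `Σᵢ rᵢ^{n+2} cᵢ → c_{i₀}`. -/
theorem tendsto_tsum_pow_mul (hr0 : ∀ i, 0 ≤ r i) (hri₀ : r i₀ = 1) (hϑ : ϑ < 1) (hrϑ : ∀ i, i ≠ i₀ → r i ≤ ϑ)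
    (hsum : Summable fun i => r i ^ 2) (hc : ∀ i, |c i| ≤ B) :
    Tendsto (fun n : ℕ => ∑' i, r i ^ (n + 2) * c i) atTop (𝓝 (c i₀)) := by
  have hϑ0 : 0 ≤ max ϑ 0 := le_max_right _ _
  have hϑ1 : max ϑ 0 < 1 := max_lt hϑ zero_lt_one
  have hgeo : Tendsto (fun n : ℕ => B * (max ϑ 0) ^ n * ∑' i, r i ^ 2) atTop (𝓝 0) := by
    have h := (tendsto_pow_atTop_nhds_zero_of_lt_one hϑ0 hϑ1).const_mul B
    have h' := h.mul_const (∑' i, r i ^ 2)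
    simpa using h'
  rw [tendsto_iff_norm_sub_tendsto_zero]
  refine squeeze_zero (fun n => norm_nonneg _) (fun n => ?_) hgeo
  rw [Real.norm_eq_abs]
  exact (abs_tsum_pow_mul_sub_le hr0 hri₀ hϑ hrϑ hsum hc n).2

end Limits

end Summit.QuantumFields.YangMills.Cruxes.IR.VacuumEscape.Spectral

end
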